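import Summits.BirchSwinnertonDyer.BirchSwinnertonDyer.Theorems.ByReductionTypeAtTwoAdditivePotGoodPrintFamily37a1Plus
import Summits.BirchSwinnertonDyer.Rank1Residual.Supersingular.RationalLadder
import HarnessLib

/-!
# K4 crux `AdditiveRankZeroAtTwo` (19098), child C3″ (22617): the `37a1`/ANS road is NOT VACUOUS — the member `m = 41`
# (`a₄₁(37a1) = −9` odd, IN THE KERNEL)

Cell `bsd-2adic`, seat `bsd-2adic-k4-w2` GEN 5 (prover, explicit unit, no kit); `--supports stmt-BirchSwinnertonDyer-22617
--as helper`. HONEST FRAMING (D-0036/D-0054): `printFamily37a1_lower_of_ARS` (`…PrintFamily37a1Plus.lean`, p681322) decides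
C3″'s conclusion `MissingLowerBoundAt W 2` (with `r_an = 0`, additive potentially good at `2`, non-CM, `W[2]` IRREDUCIBLE) at
every global minimal `W ≅ 37a1^{(−∏Q)}`, `Q` a nonempty set of primes `q ≡ 1 (mod 4)`, `q ≠ 37`, `a_q(37a1)` odd — ANS 2026
Thm. 4.3 (`n = 1`, rectangular), flag-free (audit-2 GEN 57). THIS FILE discharges the twisting hypothesis for the first printed
member `q = 41` of ANS's list (§1 Example: «41, 53, 73, 101, 149, 157, …»): `#Ẽ(𝔽₄₁) = 51` by the tree's certified `countPoints`
(`decide +kernel`), so `a₄₁ = 42 − 51 = −9` is odd. Net: `printFamily37a1_witness41` — at every global minimal model of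
`37a1^{(−41)}` (additive potentially good at `2`, `E[2]` irreducible): `r_an = 0 ∧ Addv ∧ 0 ≤ ord₂ j ∧ ¬CM ∧ Irr W 2 ∧
MissingLowerBoundAt W 2`, displaying only the base records of `printFamily37a1_lower_of_ARS` (optimal datum, `x₁`, the ANS §5.2
`χ₄`-datum `val₂ x₄ = 1`). Closes nothing at the `∀`-level; BSD is not proved by any of this.

References: [AdachiNomotoShii2026] Thm. 4.3, §1 Example, §5.2; [AgasheRibetStein2006] Thm. 2.6; [SilvermanAEC2009] V.2.
-/

set_option autoImplicit false
set_option linter.dupNamespace false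

noncomputable section

open scoped Classical


open WeierstrassCurve Literature.NumberTheory.EllipticCurves
  Literature.NumberTheory.EllipticCurves.Rank1Residual
  Literature.NumberTheory.EllipticCurves.Rank1Residual.Typed
  Literature.NumberTheory.EllipticCurves.AdachiNomotoShii2026
  Literature.NumberTheory.EllipticCurves.ModularForms
  Literature.NumberTheory.EllipticCurves.CoatesLiTianZhai2015
  Literature.NumberTheory.EllipticCurves.AgasheRibetStein2006
  Summit.BirchSwinnertonDyer.Rank1Residual
  Summit.BirchSwinnertonDyer.Rank1Residual.X5.O1
  Summit.BirchSwinnertonDyer.BirchSwinnertonDyer.Rank2Observatory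
  Summit.BirchSwinnertonDyer.BirchSwinnertonDyer.Rank2Observatory.RootNumber
  Summit.BirchSwinnertonDyer.BirchSwinnertonDyer.Rank2Observatory.Tate
  Summit.BirchSwinnertonDyer.Rank1Residual.Additive.IntModelCond
  Summit.BirchSwinnertonDyer.BirchSwinnertonDyer.Rank1Residual.IntModel
  Summit.BirchSwinnertonDyer.Rank1Residual.Supersingular
  Literature.NumberTheory.EllipticCurves.Rank1Residual.X11RankOneCertificates

namespace Summit.BirchSwinnertonDyer.BirchSwinnertonDyer.Theorems.AddPotGoodPrint

/-- The integral model of the global minimal `37a1 = [0,0,1,−1,0]` is itself. [cite: CremonaAlgorithms1997, Table 1 (37a1)] -/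
theorem integralModelInt_37a1 [(⟨0, 0, 1, -1, 0⟩ : WeierstrassCurve ℚ).IsGloballyMinimal] :
    integralModelInt (⟨0, 0, 1, -1, 0⟩ : WeierstrassCurve ℚ) = (⟨0, 0, 1, -1, 0⟩ : WeierstrassCurve ℤ) :=
  integralModelInt_eq_of_map_eq _ (map_mk_int 0 0 1 (-1) 0)

/-- **`#Ẽ(𝔽₄₁) = 51` for `37a1`** (certified point count `countPoints`, `decide +kernel`; `41 ∤ Δ = 37`).
[cite: SilvermanAEC2009, V.2] [cite: AdachiNomotoShii2026, §1 Example (41 ∈ the list)] -/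
theorem reductionPointCount_41_37a1 [(⟨0, 0, 1, -1, 0⟩ : WeierstrassCurve ℚ).IsGloballyMinimal] :
    (⟨0, 0, 1, -1, 0⟩ : WeierstrassCurve ℚ).reductionPointCount 41 = 51 := by
  haveI : Fact (Nat.Prime 41) := ⟨by norm_num⟩
  exact reductionPointCount_eq_of_intModel_countPoints integralModelInt_37a1 41 (by norm_num) (by decide +kernel)
    (by decide +kernel)

/-- **`a₄₁(37a1) = −9`** (odd): ANS's `a_q` in the tree's rendering `aq W q = q + 1 − N_q`.
[cite: AdachiNomotoShii2026, §1 Example] -/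
theorem aq_41_37a1 [(⟨0, 0, 1, -1, 0⟩ : WeierstrassCurve ℚ).IsGloballyMinimal] :
    aq (⟨0, 0, 1, -1, 0⟩ : WeierstrassCurve ℚ) 41 = -9 := by
  rw [aq, reductionPointCount_41_37a1]; norm_num

/-- **C3″'s conclusion at every global minimal model of `37a1^{(−41)}`** — the member `Q = {41}` of the ANS Thm-4.3 road
(`41 ≡ 1 (mod 4)`, `41 ≠ 37`, `a₄₁ = −9` odd — IN THE KERNEL), on top of `printFamily37a1_lower_of_ARS` (kernel: `N = 37`,
unit Manin constant by ARS, global minimality / `ũ = 1/2` / `c_∞ = 2` / habitat of the twist models). Displayed base records: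
the optimal datum (`Dt`, `hopt`), `x₁` with `L(37a1,1) = x₁·Ω`, the ANS §5.2 `χ₄`-datum (`W4`, `x₄`, `val₂ x₄ = 1`); inputs BY
NAME: ANS Thm. 4.3 (`thm43_rectangular_n1`), ARS Thm. 2.6, modularity, GZK. Conclusion: `r_an(W) = 0 ∧ Addv W 2 ∧
0 ≤ ord₂ j(W) ∧ ¬CM ∧ Irr W 2 ∧ MissingLowerBoundAt W 2`. BSD is not proved by any of this.
[cite: AdachiNomotoShii2026, Thm. 4.3 and §1 Example, §5.2] [cite: AgasheRibetStein2006, Thm. 2.6] -/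
theorem printFamily37a1_witness41 (h43 : thm43_rectangular_n1) (h26 : cremona_abs_maninConstant_eq_one_of_level_le)
    (hmod : hasEntireLFunction_rat) (hGZK : rank_eq_analyticRank_of_analyticRank_le_one)
    [(⟨0, 0, 1, -1, 0⟩ : WeierstrassCurve ℚ).IsElliptic] [(⟨0, 0, 1, -1, 0⟩ : WeierstrassCurve ℚ).IsGloballyMinimal]
    [NeZero ((⟨0, 0, 1, -1, 0⟩ : WeierstrassCurve ℚ).conductorNorm ℤ)]
    (Dt : ModularParametrizationData (⟨0, 0, 1, -1, 0⟩ : WeierstrassCurve ℚ)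
      ((⟨0, 0, 1, -1, 0⟩ : WeierstrassCurve ℚ).conductorNorm ℤ))
    (hopt : Zhai2021.IsOptimalDatum (⟨0, 0, 1, -1, 0⟩ : WeierstrassCurve ℚ) Dt)
    (x₁ : ℚ) (hx₁ : (⟨0, 0, 1, -1, 0⟩ : WeierstrassCurve ℚ).entireLFunction 1 =
      (x₁ : ℂ) * (leastRealPeriod (⟨0, 0, 1, -1, 0⟩ : WeierstrassCurve ℚ) : ℂ))
    (W4 : WeierstrassCurve ℚ) [W4.IsElliptic] [W4.IsGloballyMinimal]
    (hW4 : ∃ C : VariableChange ℚ, C • (⟨0, 0, 1, -1, 0⟩ : WeierstrassCurve ℚ).quadraticTwist (-1 : ℚ) = W4)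
    (x₄ : ℚ) (hx₄ : IsAlgPart (⟨0, 0, 1, -1, 0⟩ : WeierstrassCurve ℚ) W4 (-1) x₄) (hv₄ : val₂ x₄ = 1)
    (W : WeierstrassCurve ℚ) [W.IsElliptic] [W.IsGloballyMinimal]
    (hW : ∃ C : VariableChange ℚ, C • (⟨0, 0, 1, -1, 0⟩ : WeierstrassCurve ℚ).quadraticTwist (-41 : ℚ) = W) :
    W.analyticRank = 0 ∧ Addv W 2 ∧ 0 ≤ padicValRat 2 W.j ∧ ¬ W.HasCM ∧ Irr W 2 ∧ MissingLowerBoundAt W 2 := by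
  have hQ : ({41} : Finset ℕ).Nonempty := ⟨41, by simp⟩
  have hS : ∀ q ∈ ({41} : Finset ℕ), q.Prime ∧ q % 4 = 1 ∧ q ≠ 37 ∧
      ¬ (2 : ℤ) ∣ aq (⟨0, 0, 1, -1, 0⟩ : WeierstrassCurve ℚ) q := by
    intro q hq
    rw [Finset.mem_singleton] at hq
    subst hq
    refine ⟨by norm_num, by norm_num, by norm_num, ?_⟩
    rw [aq_41_37a1]; decide
  have hW' : ∃ C : VariableChange ℚ,
      C • (⟨0, 0, 1, -1, 0⟩ : WeierstrassCurve ℚ).quadraticTwist (-((∏ q ∈ ({41} : Finset ℕ), q : ℕ) : ℚ)) = W := by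
    rw [Finset.prod_singleton]; exact_mod_cast hW
  exact printFamily37a1_lower_of_ARS h43 h26 hmod hGZK Dt hopt x₁ hx₁ W4 hW4 x₄ hx₄ hv₄ {41} hQ hS W hW'

end Summit.BirchSwinnertonDyer.BirchSwinnertonDyer.Theorems.AddPotGoodPrint

end
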